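import Literature.RingTheory.MvPolynomial.NoetherFormsToolkit
import Mathlib.Algebra.Polynomial.Taylor
import Mathlib.Algebra.Polynomial.Derivative
import Mathlib.Algebra.Polynomial.Inductions
import HarnessLib

/-!
# Effective Noether forms, Stage I: the generic scaled truncated root of a monic bivariate
# polynomial

Support file for the proof of Kaltofen's Theorem 7 (`kaltofen1995_thm7`; E. Kaltofen, *Effective
Noether irreducibility forms and applications*, J. Comput. System Sci. 50 (1995) 274–295).
Kaltofen's absolute irreducibility test (§2) computes, for `f(x, y)` monic in `x` with `f(x, 0)`
squarefree, a truncated power-series root `α(y)` of `f` by Newton iteration over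
`R = K[z]/(f(z, 0))` and reads irreducibility off a linear system built from the powers of `α`;
§3 (Lemma 1, Thms. 1–2) bounds degrees and norms of everything for a GENERIC monic input
`f = x^d + Σ c_{ij} xⁱ yʲ`, the coefficients `c_{ij}` being indeterminates.

This file carries out the generic computation in a form chosen for formalisation (it is NOT
Kaltofen's Newton/Hensel organisation, and it is division- and resultant-free):

* `genF0 d = z^d + Σ_{i<d} c_{i0} zⁱ ∈ E₂[z]` (`E₂ = ℤ[c_{ij} : i < d, j ≤ d]`), `deltaHat d = genF0'`,
  the two-variable structure through the explicit sum `Fat φ x y = x^d + Σ φ(c_{ij}) xⁱ yʲ`, its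
  splitting `Fat = genF0(x) + y · Gat` and the Taylor remainder `genQ`
  (`genF0(z + h) = genF0(z) + genF0'(z) h + h² genQ(h)`, via Mathlib's `Polynomial.taylor`).
* Reduction modulo the generic monic `genF0`: `zpow d k ≡ z^k`, of degree `< d`, and the linear
  map `reduce` (Kaltofen's Lemma 1 device `z^j mod f₀(z) = Σ b_{j,ι} zᶥ`), coefficientwise on
  `E₂[z][y]` as `reduceY`.
* The SCALED root iteration in `B = E₂[z][y]`: with `δ = genF0'(z)` and `y` rescaled by `δ²`,
  `Fat(z + δ A, δ² y) = genF0(z) + δ² (A - Nop A)` EXACTLY (`Fat_scaled`), where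
  `Nop A = -(A² genQ(δA) + y Gat(z + δA, δ²y))`; the iterates `Abar d 0 = 0`,
  `Abar d (k+1) = truncY (k+2) (reduceY (Nop (Abar d k)))` satisfy
  `y^{k+1} ∣ Abar d k - reduceY (Nop (Abar d k))` (`Abar_spec`, a `y`-adic contraction argument).
  Under any specialisation `φ : E₂ → k`, `ζ₀` a root of `genF0^φ` with `δ₀ = (genF0^φ)'(ζ₀)`,
  this yields `y^{k+1} ∣ Fat^φ(ζ₀ + δ₀ Ā^φ(y), δ₀² y)` (`Fat_specialize_dvd`): `ζ₀ + δ₀ Ā^φ(y)` is the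
  power-series root `α(δ₀² y)` truncated — Kaltofen's `α` with the denominators `(∂f/∂x)(ζ,0)^{2k-1}`
  absorbed into the rescaling of `y` instead of being cleared through the resultant `ρ`.
* Graded bookkeeping (`ZHom`/`YZHom` of the toolkit with weights `wt d (i,j) = d - i`, `z ↦ 1`,
  `y ↦ -(2d-2)`): `genF0`, `zpow`, `reduce`, `genQ`, `Nop`, `Abar` are all weighted homogeneous
  (`Abar` of weight `2 - d`).

Norm bounds for these objects are in the sequel file. Nothing here is a cited statement; the
docstrings point to the step of [Kaltofen1995] each device replaces.

## References

* E. Kaltofen, J. Comput. System Sci. 50 (1995) 274–295, §2 (Step N), §3 Lemma 1, Thms. 1–2.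
  [`Kaltofen1995`]
-/

noncomputable section

open Polynomial

namespace Literature.RingTheory.MvPolynomial.NoetherForms

/-! ### The generic monic polynomial and its rings

Everything is first developed over an ARBITRARY commutative ring `R` with a coefficient vector
`a : Idx d → R` (the would-be generic coefficients); the generic case is `R = E₂ d`,
`a = MvPolynomial.X`, and a specialisation is `a = φ ∘ X`. All constructions commute with ring
homomorphisms (`map_…` lemmas), which is how the generic computation is transported to a field. -/

/-- Index of the generic coefficient `c_{ij}` of `xⁱ yʲ`: `i < d`, `j ≤ d`. [folklore] -/
abbrev Idx (d : ℕ) := Fin d × Fin (d + 1)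

/-- `E₂ = ℤ[c_{ij}]`, Kaltofen's `D = ℤ[…, c_{e₁,e₂}, …]` (§3). [cite: Kaltofen1995, §3 (before Lemma 1)] -/
abbrev E₂ (d : ℕ) := MvPolynomial (Idx d) ℤ

/-- The weights `w(c_{ij}) = d - i` making the generic polynomial isobaric. [folklore] -/
def wt (d : ℕ) : Idx d → ℤ := fun ij => (d : ℤ) - (ij.1 : ℕ)

variable {R : Type*} [CommRing R] (d : ℕ) (a : Idx d → R)

/-- `genF0 a = z^d + Σ_{i<d} a_{i,0} zⁱ`: the polynomial `f(z, 0)` (Kaltofen's `f₀`) of the monic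
bivariate `f = x^d + Σ a_{ij} xⁱ yʲ`. [cite: Kaltofen1995, §3 (7)] -/
def genF0 : R[X] :=
  X ^ d + ∑ i : Fin d, C (a (i, (0 : Fin (d + 1)))) * X ^ (i : ℕ)

/-- `δ̂ = genF0'(z)`; its value at a root `ζ` is `(∂f/∂x)(ζ, 0)`, the quantity Newton's iteration
divides by (Kaltofen §2, Step N, `β₀ = 1/(∂f/∂x)(α₀, 0)`). [cite: Kaltofen1995, §2 (Step N)] -/
def deltaHat : R[X] := derivative (genF0 d a)

/-- The monic bivariate polynomial with coefficient vector `a`, as an explicit sum evaluated at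
`(x, y)`: `Fat a x y = x^d + Σ_{i<d, j≤d} a_{ij} xⁱ yʲ`. [cite: Kaltofen1995, §3 (generic `f`)] -/
def Fat (x y : R) : R :=
  x ^ d + ∑ ij : Idx d, a ij * x ^ (ij.1 : ℕ) * y ^ (ij.2 : ℕ)

/-- The part of `Fat` divisible by `y`, divided by `y`: `Gat a x y = Σ_{i<d, 1≤j≤d} a_{ij} xⁱ y^{j-1}`.
[folklore] -/
def Gat (x y : R) : R :=
  ∑ ij : Fin d × Fin d, a (ij.1, ij.2.succ) * x ^ (ij.1 : ℕ) * y ^ (ij.2 : ℕ)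

/-- `Fat(x, y) = genF0(x) + y · Gat(x, y)`. [folklore] -/
theorem Fat_eq (x y : R) : Fat d a x y = (genF0 d a).eval x + y * Gat d a x y := by
  unfold Fat Gat genF0
  simp only [eval_add, eval_X_pow, eval_finsetSum, eval_mul, eval_C]
  rw [Fintype.sum_prod_type, Fintype.sum_prod_type, Finset.mul_sum, add_assoc,
    ← Finset.sum_add_distrib]
  congr 1
  refine Finset.sum_congr rfl fun i _ => ?_
  rw [Fin.sum_univ_succ, Finset.mul_sum]
  simp only [Fin.val_zero, pow_zero, mul_one, Fin.val_succ, pow_succ]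
  congr 1
  refine Finset.sum_congr rfl fun j _ => ?_
  ring

/-- `Fat` commutes with ring homomorphisms. [folklore] -/
theorem map_Fat {T : Type*} [CommRing T] (ψ : R →+* T) (x y : R) :
    ψ (Fat d a x y) = Fat d (ψ ∘ a) (ψ x) (ψ y) := by
  unfold Fat
  simp only [map_add, map_pow, map_sum, map_mul, Function.comp_apply]

/-- `Gat` commutes with ring homomorphisms. [folklore] -/
theorem map_Gat {T : Type*} [CommRing T] (ψ : R →+* T) (x y : R) :
    ψ (Gat d a x y) = Gat d (ψ ∘ a) (ψ x) (ψ y) := by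
  unfold Gat
  simp only [map_sum, map_mul, map_pow, Function.comp_apply]

/-- `genF0` commutes with ring homomorphisms. [folklore] -/
theorem map_genF0 {T : Type*} [CommRing T] (ψ : R →+* T) :
    (genF0 d a).map ψ = genF0 d (ψ ∘ a) := by
  unfold genF0
  simp only [Polynomial.map_add, Polynomial.map_pow, map_X, Polynomial.map_sum,
    Polynomial.map_mul, map_C, Function.comp_apply]

/-- `deltaHat` commutes with ring homomorphisms. [folklore] -/
theorem map_deltaHat {T : Type*} [CommRing T] (ψ : R →+* T) :
    (deltaHat d a).map ψ = deltaHat d (ψ ∘ a) := by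
  rw [deltaHat, ← derivative_map, map_genF0, deltaHat]

/-! ### `genF0`: coefficients, monicity -/

/-- The coefficients of `genF0`: `1` at `z^d`, `a_{m,0}` at `z^m` (`m < d`), `0` above. [folklore] -/
theorem coeff_genF0 (m : ℕ) :
    (genF0 d a).coeff m =
      if h : m < d then a (⟨m, h⟩, (0 : Fin (d + 1))) else if m = d then 1 else 0 := by
  unfold genF0
  rw [coeff_add, coeff_X_pow, finsetSum_coeff]
  simp only [coeff_C_mul, coeff_X_pow]
  by_cases h : m < d
  · rw [dif_pos h, if_neg (by omega), zero_add,
      Finset.sum_eq_single (⟨m, h⟩ : Fin d) (fun b _ hb => ?_) (fun hh => (hh (Finset.mem_univ _)).elim)]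
    · simp
    · rw [if_neg, mul_zero]
      exact fun hm => hb (Fin.ext hm.symm)
  · rw [dif_neg h, Finset.sum_eq_zero (fun i _ => ?_), add_zero]
    rw [if_neg (by have := i.2; omega), mul_zero]

/-- The tail `Σ_{i<d} a_{i0} zⁱ` has degree `< d`. [folklore] -/
theorem degree_genF0_tail_lt [Nontrivial R] :
    (∑ i : Fin d, C (a (i, (0 : Fin (d + 1)))) * (X : R[X]) ^ (i : ℕ)).degree < (d : WithBot ℕ) := by
  refine (degree_sum_le _ _).trans_lt ?_
  refine (Finset.sup_lt_iff (WithBot.bot_lt_coe d)).mpr fun i _ => ?_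
  refine (degree_C_mul_X_pow_le (i : ℕ) _).trans_lt ?_
  exact WithBot.coe_lt_coe.mpr i.2

/-- `genF0` is monic. [folklore] -/
theorem monic_genF0 : (genF0 d a).Monic := by
  nontriviality R
  unfold genF0
  refine (monic_X_pow d).add_of_left ?_
  rw [degree_X_pow]
  exact degree_genF0_tail_lt d a

/-- `deg genF0 = d`. [folklore] -/
theorem natDegree_genF0 [Nontrivial R] : (genF0 d a).natDegree = d := by
  unfold genF0
  rw [natDegree_add_eq_left_of_degree_lt, natDegree_X_pow]
  rw [degree_X_pow]
  exact degree_genF0_tail_lt d a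

/-- `deg genF0 ≤ d` (no nontriviality needed). [folklore] -/
theorem natDegree_genF0_le : (genF0 d a).natDegree ≤ d := by
  unfold genF0
  refine (natDegree_add_le _ _).trans (max_le (natDegree_X_pow_le d) ?_)
  refine natDegree_sum_le_of_forall_le _ _ fun i _ => (natDegree_C_mul_X_pow_le _ _).trans ?_
  exact i.2.le

/-- The `z^d`-coefficient of `genF0` is `1`. [folklore] -/
theorem coeff_genF0_d : (genF0 d a).coeff d = 1 := by
  rw [coeff_genF0, dif_neg (lt_irrefl d), if_pos rfl]

/-! ### The Taylor remainder `genQ` -/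

/-- Hasse derivatives commute with `map`. [folklore] -/
theorem hasseDeriv_map {S T : Type*} [CommRing S] [CommRing T] (f : S →+* T) (k : ℕ) (p : S[X]) :
    hasseDeriv k (p.map f) = (hasseDeriv k p).map f := by
  ext n
  rw [hasseDeriv_coeff, coeff_map, coeff_map, hasseDeriv_coeff, map_mul, map_natCast]

/-- `genQ`, the second Taylor remainder of `genF0` at `z`, as a polynomial in `h` over `R[z]`:
`genF0(z + h) = genF0(z) + genF0'(z) h + h² genQ(h)` (`aeval_genF0_add`). Its `hⁿ`-coefficient is the
Hasse derivative `D^{(n+2)} genF0` (`coeff_genQ`). [folklore] -/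
def genQ : Polynomial R[X] :=
  divX (divX (taylor (X : R[X]) ((genF0 d a).map (C : R →+* R[X]))))

/-- The coefficients of `genQ` are the Hasse derivatives of `genF0` of order `≥ 2`. [folklore] -/
theorem coeff_genQ (n : ℕ) : (genQ d a).coeff n = hasseDeriv (n + 2) (genF0 d a) := by
  rw [genQ, coeff_divX, coeff_divX, taylor_coeff, hasseDeriv_map, eval_map, eval₂_C_X]

/-- Taylor's formula for `genF0` in the `R[z]`-algebra `R[z][y]`:
`genF0(z + H) = genF0(z) + δ̂ H + H² genQ(H)`. [folklore] -/
theorem aeval_genF0_add (H : Polynomial R[X]) :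
    aeval (C (X : R[X]) + H) (genF0 d a) =
      C (genF0 d a) + C (deltaHat d a) * H + H ^ 2 * aeval H (genQ d a) := by
  set f : Polynomial R[X] := (genF0 d a).map (C : R →+* R[X]) with hf
  have h1 : aeval H (taylor (X : R[X]) f) = aeval (C (X : R[X]) + H) (genF0 d a) := by
    rw [taylor_apply, aeval_comp]
    simp only [map_add, aeval_X, aeval_C, Polynomial.algebraMap_apply, Algebra.algebraMap_self,
      RingHom.id_apply]
    rw [hf, ← Polynomial.algebraMap_eq (R := R), aeval_map_algebraMap, add_comm]
  have h2 : taylor (X : R[X]) f = C (genF0 d a) + X * (C (deltaHat d a) + X * genQ d a) := by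
    have e1 := divX_mul_X_add (taylor (X : R[X]) f)
    have e2 := divX_mul_X_add (divX (taylor (X : R[X]) f))
    rw [coeff_divX, zero_add, taylor_coeff_one, hf, derivative_map, eval_map, eval₂_C_X] at e2
    rw [taylor_coeff_zero, hf, eval_map, eval₂_C_X] at e1
    rw [← e1, ← e2, genQ, ← hf, deltaHat]
    ring
  rw [← h1, h2]
  simp only [map_add, map_mul, aeval_C, aeval_X, Polynomial.algebraMap_eq]
  ring

/-- `genQ` commutes with ring homomorphisms. [folklore] -/
theorem map_genQ {T : Type*} [CommRing T] (ψ : R →+* T) :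
    (genQ d a).map (mapRingHom ψ) = genQ d (ψ ∘ a) := by
  ext n : 1
  rw [coeff_map, coeff_genQ, coeff_genQ, coe_mapRingHom, ← map_genF0 d a ψ, hasseDeriv_map]

/-! ### Reduction modulo the monic `genF0` (Kaltofen's Lemma 1 device) -/

/-- `zpow d a k`: the canonical representative of `z^k` modulo `genF0` (degree `< d`), computed by
`z · zpow k` minus the right multiple of `genF0` (Kaltofen, Lemma 1: `z^j mod f₀(z) =
Σ b_{j,ι} zᶥ`). [cite: Kaltofen1995, Lemma 1] -/
def zpow : ℕ → R[X]
  | 0 => 1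
  | k + 1 => X * zpow k - C ((X * zpow k).coeff d) * genF0 d a

/-- `zpow 0 = 1`. [folklore] -/
@[simp] theorem zpow_zero : zpow d a 0 = 1 := rfl

/-- The recursion for `zpow`. [folklore] -/
theorem zpow_succ (k : ℕ) :
    zpow d a (k + 1) = X * zpow d a k - C ((X * zpow d a k).coeff d) * genF0 d a := rfl

/-- `zpow k ≡ z^k (mod genF0)`. [folklore] -/
theorem genF0_dvd_zpow_sub (k : ℕ) : genF0 d a ∣ zpow d a k - X ^ k := by
  induction k with
  | zero => simp
  | succ k ih =>
    rw [zpow_succ, pow_succ']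
    have : X * zpow d a k - C ((X * zpow d a k).coeff d) * genF0 d a - X * X ^ k =
        X * (zpow d a k - X ^ k) + (- C ((X * zpow d a k).coeff d)) * genF0 d a := by ring
    rw [this]
    exact dvd_add (dvd_mul_of_dvd_right ih _) (dvd_mul_left _ _)

/-- `deg zpow k < d` (`d ≥ 1`). [folklore] -/
theorem natDegree_zpow_lt (hd : 0 < d) (k : ℕ) : (zpow d a k).natDegree < d := by
  induction k with
  | zero => simpa using hd
  | succ k ih =>
    rw [zpow_succ]
    have hq : (X * zpow d a k).natDegree ≤ d := by
      refine natDegree_mul_le.trans ?_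
      refine (add_le_add natDegree_X_le le_rfl).trans ?_
      omega
    have hle : (X * zpow d a k - C ((X * zpow d a k).coeff d) * genF0 d a).natDegree ≤ d := by
      refine (natDegree_sub_le _ _).trans (max_le hq ?_)
      refine natDegree_mul_le.trans ?_
      rw [natDegree_C, zero_add]
      exact natDegree_genF0_le d a
    refine Nat.lt_of_le_of_ne hle fun heq => ?_
    have hzero : (X * zpow d a k - C ((X * zpow d a k).coeff d) * genF0 d a).coeff d = 0 := by
      rw [coeff_sub, coeff_C_mul, coeff_genF0_d, mul_one, sub_self]
    have hne : X * zpow d a k - C ((X * zpow d a k).coeff d) * genF0 d a ≠ 0 := by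
      intro h0
      rw [h0, natDegree_zero] at heq
      omega
    exact (leadingCoeff_ne_zero.mpr hne) (by rw [leadingCoeff, heq, hzero])

/-- Below degree `d` nothing is reduced: `zpow k = z^k` for `k < d`. [folklore] -/
theorem zpow_eq_X_pow {k : ℕ} (hk : k < d) : zpow d a k = X ^ k := by
  induction k with
  | zero => simp
  | succ k ih =>
    rw [zpow_succ, ih (by omega), ← pow_succ', coeff_X_pow, if_neg (by omega), map_zero,
      zero_mul, sub_zero]

/-- `zpow` commutes with ring homomorphisms. [folklore] -/
theorem map_zpow {T : Type*} [CommRing T] (ψ : R →+* T) (k : ℕ) :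
    (zpow d a k).map ψ = zpow d (ψ ∘ a) k := by
  induction k with
  | zero => simp
  | succ k ih =>
    rw [zpow_succ, zpow_succ, Polynomial.map_sub, Polynomial.map_mul, map_X, ih,
      Polynomial.map_mul, map_C, map_genF0, ← ih, ← map_X ψ, ← Polynomial.map_mul, coeff_map]

/-- `reduce`: the `R`-linear map `Σ rₖ z^k ↦ Σ rₖ · zpow k`, the canonical reduction modulo
`genF0`. [cite: Kaltofen1995, Lemma 1] -/
def reduce : R[X] →ₗ[R] R[X] :=
  Polynomial.lsum fun k => LinearMap.toSpanSingleton R R[X] (zpow d a k)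

/-- `reduce P = Σ_{k ∈ supp P} P_k · zpow k`. [folklore] -/
theorem reduce_apply (P : R[X]) : reduce d a P = ∑ k ∈ P.support, C (P.coeff k) * zpow d a k := by
  rw [reduce, Polynomial.lsum_apply, Polynomial.sum_def]
  refine Finset.sum_congr rfl fun k _ => ?_
  rw [LinearMap.toSpanSingleton_apply, smul_eq_C_mul]

/-- The same sum over any finite set containing the support. [folklore] -/
theorem reduce_eq_sum_of_subset {P : R[X]} {s : Finset ℕ} (hs : P.support ⊆ s) :
    reduce d a P = ∑ k ∈ s, C (P.coeff k) * zpow d a k := by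
  rw [reduce_apply]
  refine Finset.sum_subset hs fun k _ hk => ?_
  rw [Polynomial.notMem_support_iff.mp hk, map_zero, zero_mul]

/-- `reduce P ≡ P (mod genF0)`. [folklore] -/
theorem genF0_dvd_reduce_sub (P : R[X]) : genF0 d a ∣ reduce d a P - P := by
  have h : reduce d a P - P = ∑ k ∈ P.support, C (P.coeff k) * (zpow d a k - X ^ k) := by
    calc reduce d a P - P
          = ∑ k ∈ P.support, C (P.coeff k) * zpow d a k - ∑ k ∈ P.support, C (P.coeff k) * X ^ k := by
            rw [reduce_apply, ← P.as_sum_support_C_mul_X_pow]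
      _ = _ := by
            rw [← Finset.sum_sub_distrib]
            simp only [mul_sub]
  rw [h]
  exact Finset.dvd_sum fun k _ => dvd_mul_of_dvd_right (genF0_dvd_zpow_sub d a k) _

/-- `deg (reduce P) < d` (`d ≥ 1`). [folklore] -/
theorem natDegree_reduce_lt (hd : 0 < d) (P : R[X]) : (reduce d a P).natDegree < d := by
  rw [reduce_apply]
  have : (∑ k ∈ P.support, C (P.coeff k) * zpow d a k).natDegree ≤ d - 1 := by
    refine natDegree_sum_le_of_forall_le _ _ fun k _ => natDegree_mul_le.trans ?_
    rw [natDegree_C, zero_add]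
    have := natDegree_zpow_lt d a hd k
    omega
  omega

/-- Polynomials of degree `< d` are already reduced. [folklore] -/
theorem reduce_eq_self {P : R[X]} (hP : P.natDegree < d) : reduce d a P = P := by
  rw [reduce_apply]
  conv_rhs => rw [P.as_sum_support_C_mul_X_pow]
  refine Finset.sum_congr rfl fun k hk => ?_
  rw [zpow_eq_X_pow d a ((le_natDegree_of_mem_supp k hk).trans_lt hP)]

/-- `reduce` commutes with ring homomorphisms. [folklore] -/
theorem map_reduce {T : Type*} [CommRing T] (ψ : R →+* T) (P : R[X]) :
    (reduce d a P).map ψ = reduce d (ψ ∘ a) (P.map ψ) := by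
  rw [reduce_apply, reduce_eq_sum_of_subset d (ψ ∘ a) (support_map_subset ψ P),
    Polynomial.map_sum]
  refine Finset.sum_congr rfl fun k _ => ?_
  rw [Polynomial.map_mul, map_C, map_zpow, coeff_map]

/-- `reduceY`: `reduce` applied to every `y`-coefficient of `P ∈ R[z][y]`. [folklore] -/
def reduceY : Polynomial R[X] →ₗ[R] Polynomial R[X] := mapCoeffs (reduce d a)

/-- Coefficients of `reduceY`. [folklore] -/
@[simp] theorem coeff_reduceY (P : Polynomial R[X]) (m : ℕ) :
    (reduceY d a P).coeff m = reduce d a (P.coeff m) :=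
  coeff_mapCoeffs _ _ _

/-- `reduceY` preserves divisibility by powers of `y`. [folklore] -/
theorem X_pow_dvd_reduceY {m : ℕ} {P : Polynomial R[X]} (h : (X : Polynomial R[X]) ^ m ∣ P) :
    (X : Polynomial R[X]) ^ m ∣ reduceY d a P := by
  rw [X_pow_dvd_iff] at h ⊢
  intro i hi
  rw [coeff_reduceY, h i hi, map_zero]

/-- `reduceY` commutes with ring homomorphisms. [folklore] -/
theorem map_reduceY {T : Type*} [CommRing T] (ψ : R →+* T) (P : Polynomial R[X]) :
    (reduceY d a P).map (mapRingHom ψ) = reduceY d (ψ ∘ a) (P.map (mapRingHom ψ)) := by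
  ext m : 1
  rw [coeff_map, coeff_reduceY, coeff_reduceY, coeff_map, coe_mapRingHom, map_reduce]

/-! ### The scaled root iteration in `R[z][y]` -/

/-- The coefficient map `R → R[z][y]`. [folklore] -/
abbrev cB : R →+* Polynomial R[X] := (C : R[X] →+* Polynomial R[X]).comp (C : R →+* R[X])

/-- `δ̂ = genF0'(z)` as an element of `R[z][y]`. [folklore] -/
abbrev δB : Polynomial R[X] := C (deltaHat d a)

/-- The iteration operator: `Nop A = -(A² genQ(δ̂A) + y Gat(z + δ̂A, δ̂²y))`; a fixed point `A` of
`Nop` (modulo `genF0`) is `(α(δ̂²y) - z)/δ̂` for the power-series root `α`. [folklore] -/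
def Nop (A : Polynomial R[X]) : Polynomial R[X] :=
  -(A ^ 2 * (genQ d a).eval₂ C (δB d a * A) +
    X * Gat d (cB ∘ a) (C X + δB d a * A) (δB d a ^ 2 * X))

/-- The KEY IDENTITY of the scaled iteration:
`Fat(z + δ̂A, δ̂²y) = genF0(z) + δ̂²(A - Nop A)` in `R[z][y]`, exactly. [folklore] -/
theorem Fat_scaled (A : Polynomial R[X]) :
    Fat d (cB ∘ a) (C X + δB d a * A) (δB d a ^ 2 * X) =
      C (genF0 d a) + δB d a ^ 2 * (A - Nop d a A) := by
  rw [Fat_eq, Nop]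
  have h1 : (genF0 d (cB ∘ a)).eval (C X + δB d a * A) =
      aeval (C (X : R[X]) + δB d a * A) (genF0 d a) := by
    rw [← map_genF0, eval_map, aeval_def]
    rfl
  have h2 : (genQ d a).eval₂ C (δB d a * A) = aeval (δB d a * A) (genQ d a) := by
    rw [aeval_def, Polynomial.algebraMap_eq]
  rw [h1, h2, aeval_genF0_add]
  ring

/-- The iterates `Ā_k`: `Ā₀ = 0`, `Ā_{k+1} = trunc_{k+2}(reduce(Nop Ā_k))`. [folklore] -/
def Abar : ℕ → Polynomial R[X]
  | 0 => 0
  | k + 1 => truncY (k + 2) (reduceY d a (Nop d a (Abar k)))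

/-- `Ā₀ = 0`. [folklore] -/
@[simp] theorem Abar_zero : Abar d a 0 = 0 := rfl

/-- The recursion for `Ā`. [folklore] -/
theorem Abar_succ (k : ℕ) : Abar d a (k + 1) = truncY (k + 2) (reduceY d a (Nop d a (Abar d a k))) :=
  rfl

/-- `Gat` is polynomial in its first argument: `x - x' ∣ Gat(x, y) - Gat(x', y)`. [folklore] -/
theorem sub_dvd_Gat_sub {T : Type*} [CommRing T] (b : Idx d → T) (x x' y : T) :
    x - x' ∣ Gat d b x y - Gat d b x' y := by
  unfold Gat
  rw [← Finset.sum_sub_distrib]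
  refine Finset.dvd_sum fun ij _ => ?_
  have : b (ij.1, ij.2.succ) * x ^ (ij.1 : ℕ) * y ^ (ij.2 : ℕ) -
      b (ij.1, ij.2.succ) * x' ^ (ij.1 : ℕ) * y ^ (ij.2 : ℕ) =
      b (ij.1, ij.2.succ) * y ^ (ij.2 : ℕ) * (x ^ (ij.1 : ℕ) - x' ^ (ij.1 : ℕ)) := by
    ring
  rw [this]
  exact dvd_mul_of_dvd_right (sub_dvd_pow_sub_pow x x' _) _

/-- `eval₂ C` differences: `x - x' ∣ p(x) - p(x')`. [folklore] -/
theorem sub_dvd_eval₂_C_sub {S : Type*} [CommRing S] (x x' : S[X]) (p : S[X]) :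
    x - x' ∣ p.eval₂ C x - p.eval₂ C x' := by
  rw [← eval_map, ← eval_map]
  exact sub_dvd_eval_sub x x' _

/-- `Nop` is a `y`-adic contraction on elements without constant term:
`y^m ∣ A - A'`, `y ∣ A`, `y ∣ A'` imply `y^{m+1} ∣ Nop A - Nop A'`. [folklore] -/
theorem X_pow_succ_dvd_Nop_sub {m : ℕ} {A A' : Polynomial R[X]}
    (hAA' : (X : Polynomial R[X]) ^ m ∣ A - A') (hA : (X : Polynomial R[X]) ∣ A)
    (hA' : (X : Polynomial R[X]) ∣ A') :
    (X : Polynomial R[X]) ^ (m + 1) ∣ Nop d a A - Nop d a A' := by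
  have e : Nop d a A - Nop d a A' =
      -((A - A') * (A + A') * (genQ d a).eval₂ C (δB d a * A)
        + A' ^ 2 * ((genQ d a).eval₂ C (δB d a * A) - (genQ d a).eval₂ C (δB d a * A'))
        + X * (Gat d (cB ∘ a) (C X + δB d a * A) (δB d a ^ 2 * X) -
                Gat d (cB ∘ a) (C X + δB d a * A') (δB d a ^ 2 * X))) := by
    unfold Nop
    ring
  have hδ : (X : Polynomial R[X]) ^ m ∣ δB d a * A - δB d a * A' := by
    have : δB d a * A - δB d a * A' = δB d a * (A - A') := by ring
    rw [this]
    exact dvd_mul_of_dvd_right hAA' _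
  have t1 : (X : Polynomial R[X]) ^ (m + 1) ∣ (A - A') * (A + A') * (genQ d a).eval₂ C (δB d a * A) := by
    rw [pow_succ]
    exact dvd_mul_of_dvd_left (mul_dvd_mul hAA' (dvd_add hA hA')) _
  have t2 : (X : Polynomial R[X]) ^ (m + 1) ∣
      A' ^ 2 * ((genQ d a).eval₂ C (δB d a * A) - (genQ d a).eval₂ C (δB d a * A')) := by
    rw [pow_succ']
    exact mul_dvd_mul (dvd_pow hA' two_ne_zero) (hδ.trans (sub_dvd_eval₂_C_sub _ _ _))
  have t3 : (X : Polynomial R[X]) ^ (m + 1) ∣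
      X * (Gat d (cB ∘ a) (C X + δB d a * A) (δB d a ^ 2 * X) -
        Gat d (cB ∘ a) (C X + δB d a * A') (δB d a ^ 2 * X)) := by
    rw [pow_succ']
    refine mul_dvd_mul_left _ (dvd_trans ?_ (sub_dvd_Gat_sub d _ _ _ _))
    have : C X + δB d a * A - (C X + δB d a * A') = δB d a * A - δB d a * A' := by ring
    rw [this]
    exact hδ
  rw [e]
  exact (dvd_add (dvd_add t1 t2) t3).neg_right

/-- `y ∣ A` implies `y ∣ Nop A`. [folklore] -/
theorem X_dvd_Nop {A : Polynomial R[X]} (hA : (X : Polynomial R[X]) ∣ A) :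
    (X : Polynomial R[X]) ∣ Nop d a A := by
  unfold Nop
  exact (dvd_add (dvd_mul_of_dvd_left (dvd_pow hA two_ne_zero) _) (dvd_mul_right _ _)).neg_right

/-- The iterates have no constant term and are fixed by `reduce ∘ Nop` to increasing `y`-adic
precision: `y ∣ Ā_k` and `y^{k+1} ∣ Ā_k - reduce(Nop Ā_k)`. [folklore] -/
theorem Abar_spec (k : ℕ) :
    (X : Polynomial R[X]) ∣ Abar d a k ∧
      (X : Polynomial R[X]) ^ (k + 1) ∣ Abar d a k - reduceY d a (Nop d a (Abar d a k)) := by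
  induction k with
  | zero =>
    refine ⟨dvd_zero _, ?_⟩
    have h : (X : Polynomial R[X]) ^ (0 + 1) ∣ Nop d a 0 := by
      rw [zero_add, pow_one]
      exact X_dvd_Nop d a (dvd_zero _)
    have : Abar d a 0 - reduceY d a (Nop d a (Abar d a 0)) = -(reduceY d a (Nop d a 0)) := by
      rw [Abar_zero]
      ring
    rw [this]
    exact (X_pow_dvd_reduceY d a h).neg_right
  | succ k ih =>
    obtain ⟨h1, h2⟩ := ih
    -- `Ā_{k+1} ≡ reduce (Nop Ā_k) (mod y^{k+2})`
    have h3 : (X : Polynomial R[X]) ^ (k + 2) ∣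
        Abar d a (k + 1) - reduceY d a (Nop d a (Abar d a k)) := by
      have : Abar d a (k + 1) - reduceY d a (Nop d a (Abar d a k)) =
          -(reduceY d a (Nop d a (Abar d a k)) - Abar d a (k + 1)) := by ring
      rw [this, Abar_succ]
      exact (X_pow_dvd_sub_truncY _ _).neg_right
    -- hence `Ā_{k+1} ≡ Ā_k (mod y^{k+1})`
    have h4 : (X : Polynomial R[X]) ^ (k + 1) ∣ Abar d a k - Abar d a (k + 1) := by
      have : Abar d a k - Abar d a (k + 1) = (Abar d a k - reduceY d a (Nop d a (Abar d a k))) -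
          (Abar d a (k + 1) - reduceY d a (Nop d a (Abar d a k))) := by ring
      rw [this]
      exact dvd_sub h2 ((pow_dvd_pow X (Nat.le_succ _)).trans h3)
    -- `y ∣ Ā_{k+1}`
    have h5 : (X : Polynomial R[X]) ∣ Abar d a (k + 1) := by
      have : Abar d a (k + 1) = Abar d a k - (Abar d a k - Abar d a (k + 1)) := by ring
      rw [this]
      exact dvd_sub h1 ((dvd_pow_self X (Nat.succ_ne_zero k)).trans h4)
    refine ⟨h5, ?_⟩
    -- contraction
    have h6 := X_pow_succ_dvd_Nop_sub d a h4 h1 h5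
    have : Abar d a (k + 1) - reduceY d a (Nop d a (Abar d a (k + 1))) =
        (Abar d a (k + 1) - reduceY d a (Nop d a (Abar d a k))) +
          reduceY d a (Nop d a (Abar d a k) - Nop d a (Abar d a (k + 1))) := by
      rw [map_sub]
      ring
    rw [this]
    exact dvd_add h3 (X_pow_dvd_reduceY d a h6)

/-! ### Naturality of the iteration under ring homomorphisms -/

/-- Truncation commutes with `map`. [folklore] -/
theorem map_truncY {S T : Type*} [CommRing S] [CommRing T] (f : S →+* T) (m : ℕ) (P : S[X]) :
    (truncY m P).map f = truncY m (P.map f) := by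
  ext n
  rw [coeff_map, coeff_truncY, coeff_truncY, coeff_map]
  split_ifs
  · rfl
  · exact map_zero f

variable {T : Type*} [CommRing T] (ψ : R →+* T)

/-- `map` of `δB`. [folklore] -/
theorem map_δB : (δB d a).map (mapRingHom ψ) = δB d (ψ ∘ a) := by
  rw [δB, Polynomial.map_C, coe_mapRingHom, map_deltaHat]

/-- `map` of an `eval₂ C`. [folklore] -/
theorem map_eval₂_C (p x : Polynomial R[X]) :
    (p.eval₂ C x).map (mapRingHom ψ) =
      (p.map (mapRingHom ψ)).eval₂ C (x.map (mapRingHom ψ)) := by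
  rw [eval₂_map, ← coe_mapRingHom (f := mapRingHom ψ), hom_eval₂]
  refine congrArg (fun g => eval₂ g _ p) (RingHom.ext fun q => ?_)
  simp only [RingHom.coe_comp, Function.comp_apply, coe_mapRingHom, Polynomial.map_C]

/-- The `B`-level map composed with `cB` is `cB ∘ ψ`. [folklore] -/
theorem mapRingHom_comp_cB :
    ((mapRingHom (mapRingHom ψ) : Polynomial R[X] →+* Polynomial T[X]) : Polynomial R[X] → _) ∘
      (cB ∘ a) = cB ∘ (ψ ∘ a) := by
  ext ij n m
  simp only [Function.comp_apply, coe_mapRingHom, RingHom.coe_comp, Polynomial.map_C, coeff_C]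

/-- `Nop` commutes with ring homomorphisms. [folklore] -/
theorem map_Nop (A : Polynomial R[X]) :
    (Nop d a A).map (mapRingHom ψ) = Nop d (ψ ∘ a) (A.map (mapRingHom ψ)) := by
  unfold Nop
  rw [Polynomial.map_neg, Polynomial.map_add, Polynomial.map_mul, Polynomial.map_mul,
    Polynomial.map_pow, map_X, map_eval₂_C, map_genQ, Polynomial.map_mul, map_δB,
    ← coe_mapRingHom, map_Gat, mapRingHom_comp_cB, map_add, map_mul, map_mul, map_pow,
    coe_mapRingHom, map_δB, Polynomial.map_C, coe_mapRingHom, map_X, map_X]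

/-- `Abar` commutes with ring homomorphisms. [folklore] -/
theorem map_Abar (k : ℕ) : (Abar d a k).map (mapRingHom ψ) = Abar d (ψ ∘ a) k := by
  induction k with
  | zero => simp
  | succ k ih =>
    rw [Abar_succ, Abar_succ, map_truncY, map_reduceY, map_Nop, ih]

end Literature.RingTheory.MvPolynomial.NoetherForms
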